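import Literature.MathematicalPhysics.QuantumFieldTheory.Balaban1983to89.B13ScaledPencilAveraging
import Literature.MathematicalPhysics.QuantumFieldTheory.Balaban1983to89.B13BondAveragingReadingNumerals

/-!
# `Balaban1983to89.B13ScaledPencilBondAveraging` — T. Bałaban, *Propagators for lattice gauge theories in a background field*, Commun. Math. Phys. **99** (1985) 389–434
# [Balaban1985BackgroundPropagators], (3.12)–(3.14) pp. 392–393 (the bond averaging `Q(U)`, `Q*(U)` and their transporters `U(Γ_{y,x})`), (3.35)–(3.37) p. 396, (3.40) p. 397,
# Thm 3.4 p. 400; [Balaban1984PropagatorsI] (1.6)–(1.7) p. 18, (1.18) p. 20 («x ∈ Bᵏ(b₋)», the straight contours); [Balaban1984PropagatorsII] (2.1)–(2.4) p. 224, (2.18)–(2.19)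
# p. 226; [Balaban1988RG2Cluster] p. 15:
# ★★ STATION W4, BOND SECTOR — module 73's BOND-averaging transporter facts (`qT i parBY`, the `Q ∕ Q*` of 75∕76's local part of `Δ_a`) ALONG THE (3.37)-SCALED PENCIL
# `A″ ↦ e^{iη·w·A″}U₀`, read on the AVERAGING BOX of the coarse bond (the block `Bʲ(y₋)` plus the runs of `< Lʲ` bonds issuing from it — w4's `exists_run_of_qK_ne_zero`):
# ONE numeral `KQ′ = K₀^{(d+2)(L^k−1)}·e^{c_w(d+2)|η|Rc}`, `= e^{c_w(d+2)|η|Rc}` at a unitary-valued background, with the weight's bound `c_w·(Lʲ)⁻¹` ON THAT BOX a DISPLAYED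
# binder (the box can leave the level-`j` shell; `c_w = 1` inside the shell, `c_w = L` across one level step — the multi-level separation geometry is not read here).

statement-level bookkeeping over pv27's `prodCfg`, node00-def-Y's transporters (`parTaxiV ∕ parBY ∕ qT ∕ qK ∕ qsK`), the Setup's `iterBlock ∕ embIter ∕ runSite ∕ runBond`,
dag-n10-w3 g5's W3 `B13ScaledPencilTransport` (the box word-length bound at the scaled pencil), this seat's W4 `B13ScaledPencilAveraging` (holomorphy of the scaled words) and w4's
`B13BondAveragingReadingNumerals` (the support of `Q(y,·)` and its level-sharp range `hD_qK_level`) BY NAME, with citation tags; [folklore] modular ∕ real arithmetic; THEOREMS ONLY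
(no `def`, no instance, no notation); nothing of NODE 00's modified; nothing here is a claim about the Yang–Mills mass gap; no node is discharged; count-neutral.

WHAT THIS FILE PROVES (seat `pub-ymgap-dag-n10-w5` g4; all `theorem`s; any complete normed `ℂ`-algebra `𝔸` with `‖1‖ = 1`; the corner of the averaging box of the coarse bond
`ι` is the torus point with coordinates `val (ι₋)_ν · L^{j(ι)}`, spelled inline).
* §1 `val_blockCorner` (that corner's count is `val y_ν·Lʲ`), ★ `val_sub_blockCorner_lt_of_mem_iterBlock` (`x ∈ Bʲ(y) ⇒ (x_ν − corner_ν).val < Lʲ`), ★ `val_runSite_sub_blockCorner_lt`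
  (`⇒ ((x + te_μ)_ν − corner_ν).val < 2Lʲ` for `t < Lʲ`), `four_mul_pow_le_sitesPerDir` (`4Lʲ ≤ N` for `j ≤ k` — W2's box hypothesis for the side `2Lʲ`).
* §2 `pow_scaled_le_uniform₂` (the numeral bookkeeping), ★★ `norm_parTaxiV_scaledPencil_bondBox_le ∕ _inv_` (`qK ι f ≠ 0`, `‖A″‖ < Rc`, `‖U₀^{±1}‖ ≤ K₀`, `1 ≤ K₀`, the box-weight
  binder `hwQ` ⟹ `‖U(Γ_{embIter ι₋, f₋})^{±1}‖ ≤ K₀^{(d+2)(L^k−1)}·e^{c_w(d+2)|η|Rc}`), ★★ `norm_qT_parBY_scaledPencil_binders` (the FOUR binders for `qK ι b ≠ 0` ∕ `qsK b ι ≠ 0`,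
  `Q* = Qᵀ`); the holomorphy pair `hQh ∧ hQhi` is w4's `B13DeltaALocalFamily.differentiableOn_qT_scaledPencil` (cited, `|w| ≤ 1` from W4's `abs_weight_le_one`).
* §3 ★★★ `norm_qT_parBY_scaledPencil_binders_of_mem` — `G ≤ U(N)`, `G`-valued `U₀`: **`KQ′ = e^{c_w(d+2)|η|Rc}`**.
HONEST FRAMING: [folklore] bookkeeping over cited tree theorems; the weight `w` and its box bound `c_w` are BINDERS (which weight ∕ readings are «of record» is NODE 00's ∕
def-T's word; the value of `c_w` on print's multi-level geometry is the separation fact `lev ≥ j − 1` on the averaging box of a level-`j` bond — NOT proved here); nothing of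
Bałaban's asserted beyond the cited theorems; N06 ∕ N10 NOT discharged; K1⁹ NOT closed; counts unmoved (typed 28∕28 · discharged 5∕27); 0 `def`, 0 `sorry`, standard axioms; one
finite 𝕋⁴ programme at fixed ε — R4 closes the conditional finite-𝕋⁴ rung `BalabanLadder.UV` only; the YM mass gap (Clay) is NOT proved by any of this; nothing continuum ∕ ℝ⁴ ∕ OS.
Filed `--kind proof --supports` K1⁹ (stmt-QuantumFields-27364), Literature lane.
-/

noncomputable section

namespace Literature.MathematicalPhysics.QuantumFieldTheory.Balaban1983to89.B13ScaledPencilBondAveraging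

open Metric Set Finset
open scoped Matrix Matrix.Norms.L2Operator
open Literature.MathematicalPhysics.QuantumFieldTheory.Balaban1983to89
open Literature.MathematicalPhysics.QuantumFieldTheory.Balaban1983to89.LatticeFieldCalculus (runSite runBond)
open Literature.MathematicalPhysics.QuantumFieldTheory.Balaban1983to89.B6KLevelCensusIndexV1 (KIdx)
open Literature.MathematicalPhysics.QuantumFieldTheory.Balaban1983to89.B6GlobalChartV1 (PV boxEquiv toBox)
open Literature.MathematicalPhysics.QuantumFieldTheory.Balaban1983to89.B6Geom246MultiLevelBox (blkOf)
open Literature.MathematicalPhysics.QuantumFieldTheory.Balaban1983to89.B5Eq118OneStroke (iterBlock mem_iterBlock_iff)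
open Literature.MathematicalPhysics.QuantumFieldTheory.Balaban1983to89.B15DeterminingSets (embIter)
open Literature.MathematicalPhysics.QuantumFieldTheory.Balaban1983to89.B6Ineq2142KLevelV1 (lvl lvl_le lvl_le_mK)
open Literature.MathematicalPhysics.QuantumFieldTheory.Balaban1983to89.B6Eq238MultiLevelTorus (N0_eq_mul_Pj)
open Literature.MathematicalPhysics.QuantumFieldTheory.Balaban1983to89.B6MultiLevelBoxOperator (N0)
open Literature.MathematicalPhysics.QuantumFieldTheory.Balaban1983to89.B6Eq238MultiLevelBox (Pj one_le_Pj)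
open Literature.MathematicalPhysics.QuantumFieldTheory.Balaban1983to89.B13BondAveragingReadingNumerals (exists_run_of_qK_ne_zero hD_qK_level embIter_mem_iterBlock')
open Literature.MathematicalPhysics.QuantumFieldTheory.Balaban1983to89.B9Eq39Adjoint (prodCfg)
open Literature.MathematicalPhysics.QuantumFieldTheory.Balaban1983to89.B13ScaledPencilTransport (norm_parTaxiV_scaledPencil_le_of_box norm_parTaxiV_inv_scaledPencil_le_of_box)
open Literature.MathematicalPhysics.QuantumFieldTheory.Balaban1983to89.B13GreenPrimeSymLettersOfReg335 (norm_unit_le_one_of_mem)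
open Literature.MathematicalPhysics.QuantumFieldTheory.Balaban1983to89.Node00

variable {𝔸 : Type} [NormedRing 𝔸] [NormedAlgebra ℂ 𝔸] [CompleteSpace 𝔸] [NormOneClass 𝔸]
variable {d ℓ : ℕ} {hd : 1 ≤ d + 1} {hL : Odd (ℓ + 1) ∧ 1 < ℓ + 1} {b₀ b₁ : ℝ}
variable (i : KIdx d ℓ hd hL b₀ b₁)

/-! ## §1. The averaging box of a coarse bond: the block `Bʲ(y₋)` and the runs of `< Lʲ` bonds issuing from it lie in the torus box of side `2Lʲ` at the block's
minimal corner -/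

section Box

omit [NormedAlgebra ℂ 𝔸] [CompleteSpace 𝔸] [NormOneClass 𝔸] in
/-- the minimal corner of `Bʲ(y)` has chart coordinate `val y_ν · Lʲ < N` (the block is non-empty and its sites have coordinates `≥ val y_ν·Lʲ`).
[cite: Balaban1984PropagatorsI, (1.6) p.18, (1.18) p.20; Balaban1987RG1, (0.1) p.251, bookkeeping] -/
theorem val_blockCorner {j : ℕ} (hj : j ≤ (PV d ℓ i.m i.K hd hL).m + (PV d ℓ i.m i.K hd hL).K) (y : Site (PV d ℓ i.m i.K hd hL) j) (ν : Fin (d + 1)) :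
    ((((y ν).val * (ℓ + 1) ^ j : ℕ) : ZMod ((PV d ℓ i.m i.K hd hL).sitesPerDir 0))).val = (y ν).val * (ℓ + 1) ^ j := by
  have hx := (mem_iterBlock_iff hj y (embIter j y)).1 (embIter_mem_iterBlock' hj y) ν
  have hlt : (embIter j y ν).val < (PV d ℓ i.m i.K hd hL).sitesPerDir 0 := ZMod.val_lt _
  have hPL : (PV d ℓ i.m i.K hd hL).L = ℓ + 1 := rfl
  rw [hPL] at hx
  have hle : (y ν).val * (ℓ + 1) ^ j ≤ (embIter j y ν).val := by rw [← hx]; exact Nat.div_mul_le_self _ _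
  rw [ZMod.val_natCast, Nat.mod_eq_of_lt (lt_of_le_of_lt hle hlt)]

omit [NormedAlgebra ℂ 𝔸] [CompleteSpace 𝔸] [NormOneClass 𝔸] in
/-- ★ a site of `Bʲ(y)` lies in the box of side `Lʲ` at the minimal corner: `(x_ν − corner_ν).val < Lʲ`. [cite: Balaban1984PropagatorsI, (1.6) p.18, (1.18) p.20, bookkeeping] -/
theorem val_sub_blockCorner_lt_of_mem_iterBlock {j : ℕ} (hj : j ≤ (PV d ℓ i.m i.K hd hL).m + (PV d ℓ i.m i.K hd hL).K) {y : Site (PV d ℓ i.m i.K hd hL) j}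
    {x : Site (PV d ℓ i.m i.K hd hL) 0} (hx : x ∈ iterBlock j y) (ν : Fin (d + 1)) :
    (x ν - (((y ν).val * (ℓ + 1) ^ j : ℕ) : ZMod ((PV d ℓ i.m i.K hd hL).sitesPerDir 0))).val < (ℓ + 1) ^ j := by
  have hxν := (mem_iterBlock_iff hj y x).1 hx ν
  have hPL : (PV d ℓ i.m i.K hd hL).L = ℓ + 1 := rfl
  rw [hPL] at hxν
  have hc := val_blockCorner i hj y ν
  have hLj : 0 < (ℓ + 1) ^ j := by positivity
  have hle' : (y ν).val * (ℓ + 1) ^ j ≤ (x ν).val := by rw [← hxν]; exact Nat.div_mul_le_self _ _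
  have hlt' : (x ν).val < (y ν).val * (ℓ + 1) ^ j + (ℓ + 1) ^ j := by rw [← hxν]; exact Nat.lt_div_mul_add hLj
  have hle : ((((y ν).val * (ℓ + 1) ^ j : ℕ) : ZMod ((PV d ℓ i.m i.K hd hL).sitesPerDir 0))).val ≤ (x ν).val := by rw [hc]; exact hle'
  rw [ZMod.val_sub hle, hc]
  omega

omit [NormedAlgebra ℂ 𝔸] [CompleteSpace 𝔸] [NormOneClass 𝔸] in
/-- ★ … and the run `x + te_μ`, `t < Lʲ`, issuing from it lies in the box of side `2Lʲ` at the same corner (the count `(·).val` of a sum is at most the sum of the counts).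
[cite: Balaban1984PropagatorsI, (1.7) p.18, (1.18) p.20; Balaban1985BackgroundPropagators, (3.12) p.392, bookkeeping] -/
theorem val_runSite_sub_blockCorner_lt {j : ℕ} (hj : j ≤ (PV d ℓ i.m i.K hd hL).m + (PV d ℓ i.m i.K hd hL).K) {y : Site (PV d ℓ i.m i.K hd hL) j}
    {x : Site (PV d ℓ i.m i.K hd hL) 0} (hx : x ∈ iterBlock j y) (μ : Fin (d + 1)) {t : ℕ} (ht : t < (ℓ + 1) ^ j) (ν : Fin (d + 1)) :
    (runSite x μ t ν - (((y ν).val * (ℓ + 1) ^ j : ℕ) : ZMod ((PV d ℓ i.m i.K hd hL).sitesPerDir 0))).val < 2 * (ℓ + 1) ^ j := by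
  have hxν := val_sub_blockCorner_lt_of_mem_iterBlock i hj hx ν
  unfold LatticeFieldCalculus.runSite
  by_cases hνμ : ν = μ
  · subst hνμ
    rw [Function.update_self, add_sub_right_comm]
    refine (ZMod.val_add_le _ _).trans_lt ?_
    have htv : ((t : ZMod ((PV d ℓ i.m i.K hd hL).sitesPerDir 0))).val ≤ t := by rw [ZMod.val_natCast]; exact Nat.mod_le _ _
    omega
  · rw [Function.update_of_ne hνμ]
    omega

omit [NormedAlgebra ℂ 𝔸] [CompleteSpace 𝔸] [NormOneClass 𝔸] in
/-- `4Lʲ ≤ N` for every `j ≤ k` (`N = Lʲ·(L·M_h)·P_j`, `M_h ≥ 8`, `P′ ≥ 5`) — W2's box hypothesis for the box of side `2Lʲ`. [cite: Balaban1984PropagatorsII, (2.1)–(2.4) p.224, bookkeeping] -/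
theorem four_mul_pow_le_sitesPerDir {j : ℕ} (hj : j ≤ i.k) : 2 * (2 * (ℓ + 1) ^ j) ≤ (PV d ℓ i.m i.K hd hL).sitesPerDir 0 := by
  have hμ : Fin (d + 1) := ⟨0, by omega⟩
  rw [← i.hN hμ, N0_eq_mul_Pj hj hμ]
  have h1 : 1 ≤ Pj ℓ i.k i.P' j hμ := one_le_Pj (fun μ => le_trans (by norm_num) (i.hP5 μ)) j hμ
  have h2 : 4 ≤ (ℓ + 1) * i.Mh := le_trans (by have := i.hM8; omega) (Nat.le_mul_of_pos_left _ (Nat.succ_pos ℓ))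
  calc 2 * (2 * (ℓ + 1) ^ j) = (ℓ + 1) ^ j * 4 * 1 := by ring
    _ ≤ (ℓ + 1) ^ j * ((ℓ + 1) * i.Mh) * Pj ℓ i.k i.P' j hμ := Nat.mul_le_mul (Nat.mul_le_mul_left _ h2) h1

end Box

/-! ## §2. ★★ The bond-averaging transporter `qT i parBY` along the scaled pencil, the weight bounded ON THE AVERAGING BOX (displayed binder) -/

section Scaled

variable (U₀ : CfgY 𝔸 i) (η : ℝ) {K₀ Rc cw : ℝ} (w : Site (PV d ℓ i.m i.K hd hL) 0 → ℝ)

omit [NormedAlgebra ℂ 𝔸] [CompleteSpace 𝔸] [NormOneClass 𝔸] in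
/-- the numeral bookkeeping with a weight excess `c_w` and range factor `d+2`: `(K₀·e^{|η|·(c_w L^{−j}·Rc)})^{t} ≤ K₀^{(d+2)(L^k − 1)}·e^{c_w(d+2)|η|Rc}` for `t ≤ (d+2)(Lʲ−1)`,
`j ≤ k`. [cite: Balaban1985BackgroundPropagators, (3.37) p.396, (3.40) p.397, bookkeeping] -/
theorem pow_scaled_le_uniform₂ (hK1 : 1 ≤ K₀) (hRc : 0 ≤ Rc) (hcw : 0 ≤ cw) {j t : ℕ} (hj : j ≤ i.k) (ht : t ≤ (d + 2) * ((ℓ + 1) ^ j - 1)) :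
    (K₀ * Real.exp (|η| * ((cw * ((((ℓ : ℝ) + 1) ^ j)⁻¹)) * Rc))) ^ t ≤ K₀ ^ ((d + 2) * ((ℓ + 1) ^ i.k - 1)) * Real.exp (cw * (((d : ℝ) + 2) * (|η| * Rc))) := by
  have hLj : (0 : ℝ) < ((ℓ : ℝ) + 1) ^ j := by positivity
  have he0 : 0 ≤ |η| * ((cw * ((((ℓ : ℝ) + 1) ^ j)⁻¹)) * Rc) := by positivity
  have hb1 : 1 ≤ K₀ * Real.exp (|η| * ((cw * ((((ℓ : ℝ) + 1) ^ j)⁻¹)) * Rc)) := one_le_mul_of_one_le_of_one_le hK1 (Real.one_le_exp he0)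
  refine (pow_le_pow_right₀ hb1 ht).trans ?_
  rw [mul_pow, ← Real.exp_nat_mul]
  have hjk : (d + 2) * ((ℓ + 1) ^ j - 1) ≤ (d + 2) * ((ℓ + 1) ^ i.k - 1) :=
    Nat.mul_le_mul_left _ (Nat.sub_le_sub_right (Nat.pow_le_pow_right (Nat.succ_pos ℓ) hj) 1)
  refine mul_le_mul (pow_le_pow_right₀ hK1 hjk) (Real.exp_le_exp.2 ?_) (Real.exp_pos _).le (by positivity)
  have hcast : ((((d + 2) * ((ℓ + 1) ^ j - 1) : ℕ)) : ℝ) = ((d : ℝ) + 2) * (((ℓ : ℝ) + 1) ^ j - 1) := by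
    rw [Nat.cast_mul, Nat.cast_sub (Nat.one_le_pow _ _ (Nat.succ_pos ℓ))]; push_cast; ring
  rw [hcast]
  have hfrac : (((ℓ : ℝ) + 1) ^ j - 1) * ((((ℓ : ℝ) + 1) ^ j)⁻¹) ≤ 1 := by
    rw [sub_mul, mul_inv_cancel₀ hLj.ne', one_mul]
    linarith [inv_nonneg.2 hLj.le]
  calc ((d : ℝ) + 2) * (((ℓ : ℝ) + 1) ^ j - 1) * (|η| * ((cw * ((((ℓ : ℝ) + 1) ^ j)⁻¹)) * Rc))
      = cw * (((d : ℝ) + 2) * (|η| * Rc)) * ((((ℓ : ℝ) + 1) ^ j - 1) * ((((ℓ : ℝ) + 1) ^ j)⁻¹)) := by ring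
    _ ≤ cw * (((d : ℝ) + 2) * (|η| * Rc)) * 1 := mul_le_mul_of_nonneg_left hfrac (by positivity)
    _ = cw * (((d : ℝ) + 2) * (|η| * Rc)) := mul_one _

/-- ★★ **THE BOND-AVERAGING TRANSPORTER ALONG THE SCALED PENCIL** (`U(Γ_{y,x})` of (3.12), `x ∈ Bʲ(y₋)` plus a run of `< Lʲ` bonds): for `qK ι f ≠ 0`, `‖A″‖ < Rc`, `‖U₀^{±1}‖ ≤ K₀`,
`1 ≤ K₀`, and a weight bounded ON THE AVERAGING BOX of side `2L^{j(ι)}` at the minimal corner of `Bʲ(ι₋)` by `c_w·(L^{j(ι)})⁻¹` (DISPLAYED binder `hwQ`; `c_w = 1` inside the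
level shell, `c_w = L` across one level step — the multi-level separation geometry is not read here): `‖U(Γ)‖ ≤ K₀^{(d+2)(L^k−1)}·e^{c_w(d+2)|η|Rc}` at `U = e^{iη·w·A″}U₀`.
[cite: Balaban1985BackgroundPropagators, (3.12)–(3.14) pp.392–393, (3.35)–(3.37) p.396, (3.40) p.397, Thm 3.4 p.400; Balaban1984PropagatorsI, (1.18) p.20; Balaban1988RG2Cluster, p.15] -/
theorem norm_parTaxiV_scaledPencil_bondBox_le (hU : ∀ μ x, ‖(U₀ μ x : 𝔸)‖ ≤ K₀) (hUi : ∀ μ x, ‖(((U₀ μ x)⁻¹ : 𝔸ˣ) : 𝔸)‖ ≤ K₀) (hK1 : 1 ≤ K₀)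
    (hRc : 0 ≤ Rc) (hcw : 0 ≤ cw)
    (hwQ : ∀ (ι : IBondY i) (v : Site (PV d ℓ i.m i.K hd hL) 0),
      (∀ ν, (v ν - (((ι.1.2.src ν).val * (ℓ + 1) ^ (ι.1.1 : ℕ) : ℕ) : ZMod ((PV d ℓ i.m i.K hd hL).sitesPerDir 0))).val < 2 * (ℓ + 1) ^ (ι.1.1 : ℕ)) →
        |w v| ≤ cw * ((((ℓ : ℝ) + 1) ^ (ι.1.1 : ℕ)))⁻¹)
    {u : Fin (d + 1) → Site (PV d ℓ i.m i.K hd hL) 0 → 𝔸} (hu : u ∈ ball (0 : Fin (d + 1) → Site (PV d ℓ i.m i.K hd hL) 0 → 𝔸) Rc)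
    {ι : IBondY i} {f : FBondY i} (h : qK i ι f ≠ 0) :
    ‖(parTaxiV (prodCfg U₀ η (fun μ y => ((w y : ℝ) : ℂ) • u μ y)) (embIter (ι.1.1 : ℕ) ι.1.2.src) f.src : 𝔸)‖ ≤
      K₀ ^ ((d + 2) * ((ℓ + 1) ^ i.k - 1)) * Real.exp (cw * (((d : ℝ) + 2) * (|η| * Rc))) := by
  have hjm : (ι.1.1 : ℕ) ≤ (PV d ℓ i.m i.K hd hL).m + (PV d ℓ i.m i.K hd hL).K := lvl_le_mK i.hN i.D i.hk ι
  have hjk : (ι.1.1 : ℕ) ≤ i.k := lvl_le i.hN i.D i.hk ι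
  obtain ⟨x, hx, t, ht, hf⟩ := exists_run_of_qK_ne_zero i h
  have hsrc : f.src = runSite x ι.1.2.dir t := by rw [← hf]; rfl
  have hN := four_mul_pow_le_sitesPerDir i hjk
  have hbox := norm_parTaxiV_scaledPencil_le_of_box U₀ η
    (fun ν => (((ι.1.2.src ν).val * (ℓ + 1) ^ (ι.1.1 : ℕ) : ℕ) : ZMod ((PV d ℓ i.m i.K hd hL).sitesPerDir 0)))
    (fun _ => 2 * (ℓ + 1) ^ (ι.1.1 : ℕ)) (fun _ => hN) (zero_le_one.trans hK1) (fun μ y _ => hU μ y) (fun μ y _ => hUi μ y) w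
    (w₀ := cw * ((((ℓ : ℝ) + 1) ^ (ι.1.1 : ℕ)))⁻¹) (by positivity) (fun v hv => hwQ ι v hv) hu
    (x := embIter (ι.1.1 : ℕ) ι.1.2.src) (x' := f.src)
    (fun ν => (val_sub_blockCorner_lt_of_mem_iterBlock i hjm (embIter_mem_iterBlock' hjm _) ν).trans_le (Nat.le_mul_of_pos_left _ two_pos))
    (fun ν => by rw [hsrc]; exact val_runSite_sub_blockCorner_lt i hjm hx _ ht ν)
  exact hbox.trans (pow_scaled_le_uniform₂ i η hK1 hRc hcw hjk (hD_qK_level i h))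

/-- ★★ **… and its inverse.** [cite: Balaban1985BackgroundPropagators, (3.13) p.392, (3.5) p.391, (3.35)–(3.37) p.396, (3.40) p.397] -/
theorem norm_parTaxiV_inv_scaledPencil_bondBox_le (hU : ∀ μ x, ‖(U₀ μ x : 𝔸)‖ ≤ K₀) (hUi : ∀ μ x, ‖(((U₀ μ x)⁻¹ : 𝔸ˣ) : 𝔸)‖ ≤ K₀) (hK1 : 1 ≤ K₀)
    (hRc : 0 ≤ Rc) (hcw : 0 ≤ cw)
    (hwQ : ∀ (ι : IBondY i) (v : Site (PV d ℓ i.m i.K hd hL) 0),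
      (∀ ν, (v ν - (((ι.1.2.src ν).val * (ℓ + 1) ^ (ι.1.1 : ℕ) : ℕ) : ZMod ((PV d ℓ i.m i.K hd hL).sitesPerDir 0))).val < 2 * (ℓ + 1) ^ (ι.1.1 : ℕ)) →
        |w v| ≤ cw * ((((ℓ : ℝ) + 1) ^ (ι.1.1 : ℕ)))⁻¹)
    {u : Fin (d + 1) → Site (PV d ℓ i.m i.K hd hL) 0 → 𝔸} (hu : u ∈ ball (0 : Fin (d + 1) → Site (PV d ℓ i.m i.K hd hL) 0 → 𝔸) Rc)
    {ι : IBondY i} {f : FBondY i} (h : qK i ι f ≠ 0) :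
    ‖(((parTaxiV (prodCfg U₀ η (fun μ y => ((w y : ℝ) : ℂ) • u μ y)) (embIter (ι.1.1 : ℕ) ι.1.2.src) f.src)⁻¹ : 𝔸ˣ) : 𝔸)‖ ≤
      K₀ ^ ((d + 2) * ((ℓ + 1) ^ i.k - 1)) * Real.exp (cw * (((d : ℝ) + 2) * (|η| * Rc))) := by
  have hjm : (ι.1.1 : ℕ) ≤ (PV d ℓ i.m i.K hd hL).m + (PV d ℓ i.m i.K hd hL).K := lvl_le_mK i.hN i.D i.hk ι
  have hjk : (ι.1.1 : ℕ) ≤ i.k := lvl_le i.hN i.D i.hk ι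
  obtain ⟨x, hx, t, ht, hf⟩ := exists_run_of_qK_ne_zero i h
  have hsrc : f.src = runSite x ι.1.2.dir t := by rw [← hf]; rfl
  have hN := four_mul_pow_le_sitesPerDir i hjk
  have hbox := norm_parTaxiV_inv_scaledPencil_le_of_box U₀ η
    (fun ν => (((ι.1.2.src ν).val * (ℓ + 1) ^ (ι.1.1 : ℕ) : ℕ) : ZMod ((PV d ℓ i.m i.K hd hL).sitesPerDir 0)))
    (fun _ => 2 * (ℓ + 1) ^ (ι.1.1 : ℕ)) (fun _ => hN) (zero_le_one.trans hK1) (fun μ y _ => hU μ y) (fun μ y _ => hUi μ y) w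
    (w₀ := cw * ((((ℓ : ℝ) + 1) ^ (ι.1.1 : ℕ)))⁻¹) (by positivity) (fun v hv => hwQ ι v hv) hu
    (x := embIter (ι.1.1 : ℕ) ι.1.2.src) (x' := f.src)
    (fun ν => (val_sub_blockCorner_lt_of_mem_iterBlock i hjm (embIter_mem_iterBlock' hjm _) ν).trans_le (Nat.le_mul_of_pos_left _ two_pos))
    (fun ν => by rw [hsrc]; exact val_runSite_sub_blockCorner_lt i hjm hx _ ht ν)
  exact hbox.trans (pow_scaled_le_uniform₂ i η hK1 hRc hcw hjk (hD_qK_level i h))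

/-- ★★ **THE FOUR BOND-AVERAGING BINDERS (`qT i parBY`, for 75∕76's `Q ∕ Q*`) ALONG THE SCALED PENCIL, ONE LEVEL-FREE NUMERAL**: `qK ι b ≠ 0 ⇒ ‖qT^{±1}‖ ≤ KQ′`,
`qsK b ι ≠ 0 ⇒ ‖qT^{±1}‖ ≤ KQ′`, `KQ′ = K₀^{(d+2)(L^k−1)}·e^{c_w(d+2)|η|Rc}` (73's `qT_parBY`, NODE 00's `qsK = qKᵀ`). [cite: Balaban1985BackgroundPropagators, (3.12)–(3.14)
pp.392–393, (3.35)–(3.37) p.396, (3.40) p.397; Balaban1984PropagatorsII, (2.18)–(2.19) p.226] -/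
theorem norm_qT_parBY_scaledPencil_binders (hU : ∀ μ x, ‖(U₀ μ x : 𝔸)‖ ≤ K₀) (hUi : ∀ μ x, ‖(((U₀ μ x)⁻¹ : 𝔸ˣ) : 𝔸)‖ ≤ K₀) (hK1 : 1 ≤ K₀)
    (hRc : 0 ≤ Rc) (hcw : 0 ≤ cw)
    (hwQ : ∀ (ι : IBondY i) (v : Site (PV d ℓ i.m i.K hd hL) 0),
      (∀ ν, (v ν - (((ι.1.2.src ν).val * (ℓ + 1) ^ (ι.1.1 : ℕ) : ℕ) : ZMod ((PV d ℓ i.m i.K hd hL).sitesPerDir 0))).val < 2 * (ℓ + 1) ^ (ι.1.1 : ℕ)) →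
        |w v| ≤ cw * ((((ℓ : ℝ) + 1) ^ (ι.1.1 : ℕ)))⁻¹) :
    (∀ u ∈ ball (0 : Fin (d + 1) → Site (PV d ℓ i.m i.K hd hL) 0 → 𝔸) Rc, ∀ ι b, qK i ι b ≠ 0 →
      ‖(qT i (parBY i) (prodCfg U₀ η (fun μ y => ((w y : ℝ) : ℂ) • u μ y)) ι b : 𝔸)‖ ≤
        K₀ ^ ((d + 2) * ((ℓ + 1) ^ i.k - 1)) * Real.exp (cw * (((d : ℝ) + 2) * (|η| * Rc)))) ∧
    (∀ u ∈ ball (0 : Fin (d + 1) → Site (PV d ℓ i.m i.K hd hL) 0 → 𝔸) Rc, ∀ ι b, qK i ι b ≠ 0 →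
      ‖(((qT i (parBY i) (prodCfg U₀ η (fun μ y => ((w y : ℝ) : ℂ) • u μ y)) ι b)⁻¹ : 𝔸ˣ) : 𝔸)‖ ≤
        K₀ ^ ((d + 2) * ((ℓ + 1) ^ i.k - 1)) * Real.exp (cw * (((d : ℝ) + 2) * (|η| * Rc)))) ∧
    (∀ u ∈ ball (0 : Fin (d + 1) → Site (PV d ℓ i.m i.K hd hL) 0 → 𝔸) Rc, ∀ b ι, qsK i b ι ≠ 0 →
      ‖(((qT i (parBY i) (prodCfg U₀ η (fun μ y => ((w y : ℝ) : ℂ) • u μ y)) ι b)⁻¹ : 𝔸ˣ) : 𝔸)‖ ≤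
        K₀ ^ ((d + 2) * ((ℓ + 1) ^ i.k - 1)) * Real.exp (cw * (((d : ℝ) + 2) * (|η| * Rc)))) ∧
    (∀ u ∈ ball (0 : Fin (d + 1) → Site (PV d ℓ i.m i.K hd hL) 0 → 𝔸) Rc, ∀ b ι, qsK i b ι ≠ 0 →
      ‖(qT i (parBY i) (prodCfg U₀ η (fun μ y => ((w y : ℝ) : ℂ) • u μ y)) ι b : 𝔸)‖ ≤
        K₀ ^ ((d + 2) * ((ℓ + 1) ^ i.k - 1)) * Real.exp (cw * (((d : ℝ) + 2) * (|η| * Rc)))) := by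
  have hT : ∀ {b : FBondY i} {ι : IBondY i}, qsK i b ι ≠ 0 → qK i ι b ≠ 0 := fun h => by
    rwa [qsK_eq_transpose, Matrix.transpose_apply] at h
  exact ⟨fun u hu ι b hq => norm_parTaxiV_scaledPencil_bondBox_le i U₀ η w hU hUi hK1 hRc hcw hwQ hu hq,
    fun u hu ι b hq => norm_parTaxiV_inv_scaledPencil_bondBox_le i U₀ η w hU hUi hK1 hRc hcw hwQ hu hq,
    fun u hu b ι hq => norm_parTaxiV_inv_scaledPencil_bondBox_le i U₀ η w hU hUi hK1 hRc hcw hwQ hu (hT hq),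
    fun u hu b ι hq => norm_parTaxiV_scaledPencil_bondBox_le i U₀ η w hU hUi hK1 hRc hcw hwQ hu (hT hq)⟩

/- HOLOMORPHY (`hQh ∧ hQhi` for `qT i parBY` along the scaled pencil, every `ι, b`) is dag-n10-w4 g6's `B13DeltaALocalFamily.differentiableOn_qT_scaledPencil`
(hypothesis `|w| ≤ 1`, supplied by W4's `abs_weight_le_one` from the blockwise bound) — CITED, not restated. -/

end Scaled

/-! ## §3. ★★★ The record's corollary (`G ≤ U(N)`, `G`-valued `U₀`: `K₀ = 1`) -/

section Record

variable {N : ℕ} [NeZero N] {G : Subgroup (Matrix (Fin N) (Fin N) ℂ)ˣ}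

/-- ★★★ **THE BOND-AVERAGING BINDERS ALONG THE SCALED PENCIL ABOUT A UNITARY-VALUED BACKGROUND**: `KQ′ = e^{c_w(d+2)|η|Rc}` — no `L^k`, no level, no member size.
[cite: Balaban1985BackgroundPropagators, (3.12)–(3.14) pp.392–393, (3.35)–(3.37) p.396, (3.40) p.397; Balaban1988RG2Cluster, p.15] -/
theorem norm_qT_parBY_scaledPencil_binders_of_mem (hG : G ≤ B7Prop2Explicit.unitaryUnits (Matrix (Fin N) (Fin N) ℂ))
    {U₀ : CfgY (Matrix (Fin N) (Fin N) ℂ) i} (hU : ∀ μ x, U₀ μ x ∈ G) (η : ℝ) {Rc cw : ℝ} (hRc : 0 ≤ Rc) (hcw : 0 ≤ cw)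
    (w : Site (PV d ℓ i.m i.K hd hL) 0 → ℝ)
    (hwQ : ∀ (ι : IBondY i) (v : Site (PV d ℓ i.m i.K hd hL) 0),
      (∀ ν, (v ν - (((ι.1.2.src ν).val * (ℓ + 1) ^ (ι.1.1 : ℕ) : ℕ) : ZMod ((PV d ℓ i.m i.K hd hL).sitesPerDir 0))).val < 2 * (ℓ + 1) ^ (ι.1.1 : ℕ)) →
        |w v| ≤ cw * ((((ℓ : ℝ) + 1) ^ (ι.1.1 : ℕ)))⁻¹) :
    (∀ u ∈ ball (0 : Fin (d + 1) → Site (PV d ℓ i.m i.K hd hL) 0 → Matrix (Fin N) (Fin N) ℂ) Rc, ∀ ι b, qK i ι b ≠ 0 →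
      ‖(qT i (parBY i) (prodCfg U₀ η (fun μ y => ((w y : ℝ) : ℂ) • u μ y)) ι b : Matrix (Fin N) (Fin N) ℂ)‖ ≤
        Real.exp (cw * (((d : ℝ) + 2) * (|η| * Rc)))) ∧
    (∀ u ∈ ball (0 : Fin (d + 1) → Site (PV d ℓ i.m i.K hd hL) 0 → Matrix (Fin N) (Fin N) ℂ) Rc, ∀ ι b, qK i ι b ≠ 0 →
      ‖(((qT i (parBY i) (prodCfg U₀ η (fun μ y => ((w y : ℝ) : ℂ) • u μ y)) ι b)⁻¹ : (Matrix (Fin N) (Fin N) ℂ)ˣ) :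
        Matrix (Fin N) (Fin N) ℂ)‖ ≤ Real.exp (cw * (((d : ℝ) + 2) * (|η| * Rc)))) ∧
    (∀ u ∈ ball (0 : Fin (d + 1) → Site (PV d ℓ i.m i.K hd hL) 0 → Matrix (Fin N) (Fin N) ℂ) Rc, ∀ b ι, qsK i b ι ≠ 0 →
      ‖(((qT i (parBY i) (prodCfg U₀ η (fun μ y => ((w y : ℝ) : ℂ) • u μ y)) ι b)⁻¹ : (Matrix (Fin N) (Fin N) ℂ)ˣ) :
        Matrix (Fin N) (Fin N) ℂ)‖ ≤ Real.exp (cw * (((d : ℝ) + 2) * (|η| * Rc)))) ∧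
    (∀ u ∈ ball (0 : Fin (d + 1) → Site (PV d ℓ i.m i.K hd hL) 0 → Matrix (Fin N) (Fin N) ℂ) Rc, ∀ b ι, qsK i b ι ≠ 0 →
      ‖(qT i (parBY i) (prodCfg U₀ η (fun μ y => ((w y : ℝ) : ℂ) • u μ y)) ι b : Matrix (Fin N) (Fin N) ℂ)‖ ≤
        Real.exp (cw * (((d : ℝ) + 2) * (|η| * Rc)))) := by
  obtain ⟨hU1, hUi1⟩ := norm_unit_le_one_of_mem i hG hU
  have h := norm_qT_parBY_scaledPencil_binders i U₀ η w hU1 hUi1 le_rfl hRc hcw hwQ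
  simp only [one_pow, one_mul] at h
  exact h

end Record

end Literature.MathematicalPhysics.QuantumFieldTheory.Balaban1983to89.B13ScaledPencilBondAveraging

end
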